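import Literature.AlgebraicGeometry.Limits.LocalizationRelativeDimensionSpread
import Mathlib.RingTheory.DedekindDomain.Factorization
import HarnessLib

/-!
# Limits of schemes: good models at all but finitely many primes of a Dedekind domain
# (EGA IV₃ 8.10.5, IV₄ 17.7.8; Stacks 081F, 0C0C — the «almost all primes» reading)

Topic `Literature/AlgebraicGeometry/Limits`. Theorems only (no definition, no named fact, no instance);
the COFINITE reading of the unit-form spreading theorems `Limits/LocalizationSmoothProperSpread`
(`LocApprox.exists_forall_smooth_isProper_flat_snd_of_isUnit`) and
`Limits/LocalizationRelativeDimensionSpread`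
(`LocApprox.exists_forall_smoothOfRelativeDimension_isProper_flat_snd_of_isUnit`) over a DEDEKIND
domain `A` (e.g. a ring of `S`-integers `𝒪_E[1/N]` of a number field): the single non-zero
element `s` below which the prescribed model `P → Spec A` is smooth (of relative dimension `n`),
proper and flat lies in only finitely many maximal ideals (Mathlib `Ideal.finite_factors`), so the
conclusions hold at the local ring `A_v` of ALL BUT FINITELY MANY height-one primes `v` of `A`
(`∀ᶠ v : HeightOneSpectrum A in Filter.cofinite`), for every model `T` of `A_v`
(`IsLocalization.AtPrime T v.asIdeal`) — «good reduction outside a finite set of primes» for a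
given integral model with smooth proper generic fibre.

* `HeightOneSpectrum.eventually_not_mem` — a non-zero element of a Dedekind domain lies in only
  finitely many height-one primes.
* `LocApprox.eventually_smooth_isProper_flat_atPrime` — smooth proper generic fibre ⇒ smooth, proper,
  flat over `A_v` for almost all `v`.
* `LocApprox.eventually_smoothOfRelativeDimension_isProper_flat_atPrime` (+ `…_of_iso`) — generic
  fibre proper and smooth of relative dimension `n` (resp. identified with a given such `K`-scheme
  `E`) ⇒ the same over `A_v` for almost all `v`.
* `LocApprox.eventually_smooth_isProper_flat_residueField`,
  `LocApprox.eventually_smoothOfRelativeDimension_isProper_flat_residueField_of_iso` — the SPECIAL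
  FIBRES over the residue fields `κ(v) = A ⧸ v` are smooth (of relative dimension `n`) and proper
  for almost all `v` («the model reduces to a smooth proper curve mod `v` for almost all `v`»).

## References

* [StacksProject] The Stacks Project, Tags 081F, 0C0C.
* [EGAIV3] EGA IV₃ (Publ. Math. IHÉS 28, 1966), Thm. 8.10.5; [EGAIV4] EGA IV₄ (ibid. 32, 1967),
  Prop. 17.7.8.
-/

noncomputable section

universe u

open CategoryTheory CategoryTheory.Limits AlgebraicGeometry IsDedekindDomain

namespace Literature.AlgebraicGeometry.Limits

open Literature.AlgebraicGeometry.Motives (SchemeOver specOver)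

set_option backward.isDefEq.respectTransparency false

/-- **A non-zero element of a Dedekind domain lies in only finitely many height-one primes**
(unique factorisation of ideals; Mathlib `Ideal.finite_factors` for `(s)`). [folklore] -/
private theorem eventually_not_mem {A : Type u} [CommRing A] [IsDedekindDomain A] {s : A}
    (hs : s ≠ 0) : ∀ᶠ v : HeightOneSpectrum A in Filter.cofinite, s ∉ v.asIdeal := by
  rw [Filter.eventually_cofinite]
  refine (Ideal.finite_factors (I := Ideal.span {s}) ?_).subset ?_
  · simpa [Ideal.span_singleton_eq_bot] using hs
  · intro v hv
    simpa [Ideal.dvd_span_singleton] using hv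

/-- In the residue ring `A ⧸ 𝔪` of a maximal ideal `𝔪`, an element `s ∉ 𝔪` is a unit. [folklore] -/
private theorem isUnit_algebraMap_quotient_of_not_mem {A : Type u} [CommRing A] (m : Ideal A)
    [hm : m.IsMaximal] {s : A} (hs : s ∉ m) : IsUnit (algebraMap A (A ⧸ m) s) := by
  obtain ⟨y, i, hi, h⟩ := hm.exists_inv hs
  refine IsUnit.of_mul_eq_one (Ideal.Quotient.mk m y) ?_
  rw [Ideal.Quotient.algebraMap_eq, ← map_mul, mul_comm, ← map_one (Ideal.Quotient.mk m), ← h,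
    map_add, Ideal.Quotient.eq_zero_iff_mem.mpr hi, add_zero]

namespace LocApprox

variable {A : Type u} [CommRing A] [IsDedekindDomain A]
  (K : Type u) [Field K] [Algebra A K] [IsFractionRing A K]

/-- **Smooth proper generic fibre ⇒ smooth, proper and flat over `A_v` for all but finitely many
primes `v` of the Dedekind domain `A`** (EGA IV₃ 8.10.5 (xii), IV₄ 17.7.8 (ii); Stacks 081F, 0C0C):
`P → Spec A` quasi-compact, quasi-separated and locally of finite presentation with
`P ×_A Spec K → Spec K` smooth and proper, `K = Frac A` ⇒ for all but finitely many height-one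
primes `v` and every model `T` of `A_v`, `P ×_A Spec T → Spec T` is smooth, proper and flat.
[cite: StacksProject, Tags 081F, 0C0C] -/
theorem eventually_smooth_isProper_flat_atPrime (P : SchemeOver A) [QuasiCompact P.hom]
    [QuasiSeparated P.hom] [LocallyOfFinitePresentation P.hom]
    (hsm : Smooth (pullback.snd P.hom (Spec.map (CommRingCat.ofHom (algebraMap A K)))))
    (hpr : IsProper (pullback.snd P.hom (Spec.map (CommRingCat.ofHom (algebraMap A K))))) :
    ∀ᶠ v : HeightOneSpectrum A in Filter.cofinite,
      ∀ (T : Type u) [CommRing T] [Algebra A T] [IsLocalization.AtPrime T v.asIdeal],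
        Smooth (pullback.snd P.hom (Spec.map (CommRingCat.ofHom (algebraMap A T)))) ∧
        IsProper (pullback.snd P.hom (Spec.map (CommRingCat.ofHom (algebraMap A T)))) ∧
        Flat (pullback.snd P.hom (Spec.map (CommRingCat.ofHom (algebraMap A T)))) := by
  obtain ⟨s, hsS, H⟩ := exists_forall_smooth_isProper_flat_snd_of_isUnit K P hsm hpr
  filter_upwards [eventually_not_mem (nonZeroDivisors.ne_zero hsS)] with v hv T _ _ _
  exact H T (IsLocalization.map_units T ⟨s, show s ∈ v.asIdeal.primeCompl from hv⟩)

/-- **Generic fibre proper and smooth of relative dimension `n` ⇒ the same over `A_v` for all but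
finitely many primes `v` of the Dedekind domain `A`** (with flatness).
[cite: StacksProject, Tags 081F, 0C0C] [cite: EGAIV4, Prop. 17.7.8] -/
theorem eventually_smoothOfRelativeDimension_isProper_flat_atPrime {n : ℕ} (P : SchemeOver A)
    [QuasiCompact P.hom] [QuasiSeparated P.hom] [LocallyOfFinitePresentation P.hom]
    (hn : SmoothOfRelativeDimension n
      (pullback.snd P.hom (Spec.map (CommRingCat.ofHom (algebraMap A K)))))
    (hpr : IsProper (pullback.snd P.hom (Spec.map (CommRingCat.ofHom (algebraMap A K))))) :
    ∀ᶠ v : HeightOneSpectrum A in Filter.cofinite,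
      ∀ (T : Type u) [CommRing T] [Algebra A T] [IsLocalization.AtPrime T v.asIdeal],
        SmoothOfRelativeDimension n
            (pullback.snd P.hom (Spec.map (CommRingCat.ofHom (algebraMap A T)))) ∧
          IsProper (pullback.snd P.hom (Spec.map (CommRingCat.ofHom (algebraMap A T)))) ∧
          Flat (pullback.snd P.hom (Spec.map (CommRingCat.ofHom (algebraMap A T)))) := by
  obtain ⟨s, hsS, H⟩ :=
    exists_forall_smoothOfRelativeDimension_isProper_flat_snd_of_isUnit K P hn hpr
  filter_upwards [eventually_not_mem (nonZeroDivisors.ne_zero hsS)] with v hv T _ _ _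
  exact H T (IsLocalization.map_units T ⟨s, show s ∈ v.asIdeal.primeCompl from hv⟩)

/-- **An integral model of a given proper `K`-scheme smooth of relative dimension `n` has smooth
(of relative dimension `n`), proper, flat localisations at all but finitely many primes** — e.g. an
integral model over `𝒪_E[1/N]` of a smooth projective curve over a number field `E` is a smooth
proper family of curves over `𝒪_{E,(v)}` for almost all `v`: `e₀ : P ×_A Spec K ≅ E` with
`E → Spec K` proper and smooth of relative dimension `n`.
[cite: StacksProject, Tags 081F, 0C0C] [cite: EGAIV4, Prop. 17.7.8] -/
theorem eventually_smoothOfRelativeDimension_isProper_flat_atPrime_of_iso {n : ℕ}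
    (P : SchemeOver A) [QuasiCompact P.hom] [QuasiSeparated P.hom]
    [LocallyOfFinitePresentation P.hom] {E : SchemeOver K}
    (hEn : SmoothOfRelativeDimension n E.hom) (hEpr : IsProper E.hom)
    (e₀ : (Over.pullback (specOver A K).hom).obj P ≅ E) :
    ∀ᶠ v : HeightOneSpectrum A in Filter.cofinite,
      ∀ (T : Type u) [CommRing T] [Algebra A T] [IsLocalization.AtPrime T v.asIdeal],
        SmoothOfRelativeDimension n
            (pullback.snd P.hom (Spec.map (CommRingCat.ofHom (algebraMap A T)))) ∧
          IsProper (pullback.snd P.hom (Spec.map (CommRingCat.ofHom (algebraMap A T)))) ∧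
          Flat (pullback.snd P.hom (Spec.map (CommRingCat.ofHom (algebraMap A T)))) := by
  obtain ⟨s, hsS, H⟩ :=
    exists_forall_smoothOfRelativeDimension_isProper_flat_snd_of_iso K P hEn hEpr e₀
  filter_upwards [eventually_not_mem (nonZeroDivisors.ne_zero hsS)] with v hv T _ _ _
  exact H T (IsLocalization.map_units T ⟨s, show s ∈ v.asIdeal.primeCompl from hv⟩)

/-- **Smooth proper generic fibre ⇒ the special fibres `P ×_A Spec κ(v) → Spec κ(v)`,
`κ(v) = A ⧸ v`, are smooth, proper (and flat) for all but finitely many primes `v` of the Dedekind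
domain `A`** (the residue field `A ⧸ v` inverts the witness `s` as soon as `s ∉ v`).
[cite: StacksProject, Tags 081F, 0C0C] -/
theorem eventually_smooth_isProper_flat_residueField (P : SchemeOver A) [QuasiCompact P.hom]
    [QuasiSeparated P.hom] [LocallyOfFinitePresentation P.hom]
    (hsm : Smooth (pullback.snd P.hom (Spec.map (CommRingCat.ofHom (algebraMap A K)))))
    (hpr : IsProper (pullback.snd P.hom (Spec.map (CommRingCat.ofHom (algebraMap A K))))) :
    ∀ᶠ v : HeightOneSpectrum A in Filter.cofinite,
      Smooth (pullback.snd P.hom (Spec.map (CommRingCat.ofHom (algebraMap A (A ⧸ v.asIdeal))))) ∧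
        IsProper (pullback.snd P.hom
          (Spec.map (CommRingCat.ofHom (algebraMap A (A ⧸ v.asIdeal))))) ∧
        Flat (pullback.snd P.hom (Spec.map (CommRingCat.ofHom (algebraMap A (A ⧸ v.asIdeal))))) := by
  obtain ⟨s, hsS, H⟩ := exists_forall_smooth_isProper_flat_snd_of_isUnit K P hsm hpr
  filter_upwards [eventually_not_mem (nonZeroDivisors.ne_zero hsS)] with v hv
  haveI := v.isMaximal
  exact H (A ⧸ v.asIdeal) (isUnit_algebraMap_quotient_of_not_mem v.asIdeal hv)

/-- **An integral model of a given proper `K`-scheme smooth of relative dimension `n` has smooth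
proper special fibres of relative dimension `n` over the residue fields `κ(v) = A ⧸ v` of all but
finitely many primes `v` of the Dedekind domain `A`** — e.g. «the integral model of a smooth
projective curve over a number field `E` reduces to a smooth proper curve over `κ(v)` for almost
all primes `v` of `𝒪_E[1/N]`»: `e₀ : P ×_A Spec K ≅ E`, `E → Spec K` proper and smooth of relative
dimension `n`. [cite: StacksProject, Tags 081F, 0C0C] [cite: EGAIV4, Prop. 17.7.8] -/
theorem eventually_smoothOfRelativeDimension_isProper_flat_residueField_of_iso {n : ℕ}
    (P : SchemeOver A) [QuasiCompact P.hom] [QuasiSeparated P.hom]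
    [LocallyOfFinitePresentation P.hom] {E : SchemeOver K}
    (hEn : SmoothOfRelativeDimension n E.hom) (hEpr : IsProper E.hom)
    (e₀ : (Over.pullback (specOver A K).hom).obj P ≅ E) :
    ∀ᶠ v : HeightOneSpectrum A in Filter.cofinite,
      SmoothOfRelativeDimension n
          (pullback.snd P.hom (Spec.map (CommRingCat.ofHom (algebraMap A (A ⧸ v.asIdeal))))) ∧
        IsProper (pullback.snd P.hom
          (Spec.map (CommRingCat.ofHom (algebraMap A (A ⧸ v.asIdeal))))) ∧
        Flat (pullback.snd P.hom (Spec.map (CommRingCat.ofHom (algebraMap A (A ⧸ v.asIdeal))))) := by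
  obtain ⟨s, hsS, H⟩ :=
    exists_forall_smoothOfRelativeDimension_isProper_flat_snd_of_iso K P hEn hEpr e₀
  filter_upwards [eventually_not_mem (nonZeroDivisors.ne_zero hsS)] with v hv
  haveI := v.isMaximal
  exact H (A ⧸ v.asIdeal) (isUnit_algebraMap_quotient_of_not_mem v.asIdeal hv)

end LocApprox

end Literature.AlgebraicGeometry.Limits

end
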